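import Literature.NumberTheory.EllipticCurves.Kato2004.IwasawaCohomologyExistsProofs
import HarnessLib

/-!
# Kato 2004 (Astérisque 295) §12.2: the pinned Iwasawa cohomology `𝐇¹_Γ(T_pW)` is UNIQUE — the
# `Λ`-action of ANY datum `IwasawaH1Data W p κ γ` is computed levelwise, and any two data are
# canonically isomorphic (proofs only)

Topic `NumberTheory/EllipticCurves`, sub-directory `Kato2004` (namespace = path), sibling proof file of
`IwasawaCohomology.lean` and `IwasawaCohomologyExistsProofs.lean`.  Seat `bsd-potss-rkm` (prover, cell
`bsd-potss`, item stmt-BirchSwinnertonDyer-19196).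

The docstring of `IwasawaH1Data` asserts in prose that its axioms PIN the `Λ = ℤ_p⟦X⟧`-structure
("any two such structures agree"), with an argument through the finite generation of the levels.
This file proves the pin in the kernel, WITHOUT any finiteness: for EVERY datum `I`,

* `IwasawaH1Data.proj_coe_smul` — polynomials act levelwise through `conj_γ − 1`:
  `proj n (r • x) = r(θ_n − 1) (proj n x)`, `θ_n = conj_γ` (induction on `r` from `proj_T_smul`,
  `proj_C_smul`);
* `IwasawaH1Data.proj_omega_smul` — `proj n (ω_n • x) = 0` for `ω_n = (X+1)^{p^n} − 1`, because
  `θ_n^{p^n} = 1` (`γ^{p^n} ∈ Gal(ℚ̄/ℚ_n)` acts trivially on `H¹(ℚ_n, T_pW)`);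
* `IwasawaH1Data.proj_smul` — **the `Λ`-action is levelwise**: `proj n (f • x) = r(θ_n − 1) (proj n x)`
  for every power series `f` and every polynomial `r ≡ f (mod ω_n)`.  KEY STEP (commutativity of `Λ`):
  `f = r + ω_n q` gives `f • x = r • x + ω_n • (q • x)`, and the second term dies at level `n` whatever
  the abstract action of `q` is — so no continuity / completeness is needed;
* `IwasawaH1Data.exists_linearEquiv` — **uniqueness of the pin**: for any two data `I`, `J` there is a
  `Λ`-linear isomorphism `e : I.H ≃ₗ[Λ] J.H` with `J.proj n (e x) = I.proj n x` for all `n`, and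
  (`IwasawaH1Data.linearEquiv_unique`) it is unique.  In particular every datum is isomorphic to the
  one constructed in `IwasawaCohomologyExistsProofs.lean` (`nonempty_iwasawaH1Data_holds`), and named
  facts quantified over ALL data (`thm12_4`, `MemberHullInputs`, …) are statements about ONE module.

Everything here is proved; no definition, no named fact, no `instance`, no notation.  HONEST FRAMING:
structural bookkeeping for the vocabulary of Kato §12.2 (Lang, *Cyclotomic Fields*, Ch. 5 §1 Thm. 1.1:
a compatible system of `ℤ_p[X]/(ω_n)`-modules IS a `Λ`-module, uniquely); BSD is not advanced by it.

## References

* K. Kato, Astérisque 295 (2004), §12.2 (12.2.1) (p. 220), §13.8 (p. 228). [Kato2004Asterisque]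
* S. Lang, *Cyclotomic Fields I and II*, GTM 121 (1990), Ch. 5 §1 Thm. 1.1. [Lang1990]
* L. C. Washington, *Introduction to Cyclotomic Fields* (1997), Thm. 7.1, Prop. 7.2. [Washington1997]
-/

noncomputable section

open CategoryTheory Polynomial Field
open Literature.NumberTheory.GaloisRepresentations
open Literature.NumberTheory.EllipticCurves.Kato2004.EulerSystemValues

namespace Literature.NumberTheory.EllipticCurves.Kato2004

namespace IwasawaH1Data

variable {W : WeierstrassCurve ℚ} [W.IsElliptic] {p : ℕ} [Fact p.Prime]
  [ContinuousSMul ℤ_[p] (W.tateModule p)] {κ : ZpExtension ℚ p} {γ : absoluteGaloisGroup ℚ}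
  (I : IwasawaH1Data W p κ γ)

/-- `γ^{pⁿ} ∈ Gal(ℚ̄/ℚ_n)` for a topological generator `γ` (local copy of
`ZpExtension.pow_mem_layerSubgroup`, not imported to keep this file light). [folklore] -/
private theorem pow_mem_layerSubgroup'' (hγ : κ.IsTopGenerator γ) (n : ℕ) :
    γ ^ p ^ n ∈ κ.layerSubgroup n := by
  have hγ' : κ γ = Multiplicative.ofAdd 1 := hγ
  rw [ZpExtension.mem_layerSubgroup, map_pow, hγ', ← ofAdd_nsmul, toAdd_ofAdd, nsmul_eq_mul,
    mul_one, Nat.cast_pow]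

/-- **Polynomials act levelwise**: for every datum `I` and polynomial `r ∈ ℤ_p[X]`,
`proj n (r • x) = r(conj_γ − 1) (proj n x)` (from `proj_T_smul` and `proj_C_smul`).
[cite: Kato2004Asterisque, §12.2 (p. 220)] -/
theorem proj_coe_smul (n : ℕ) (r : ℤ_[p][X]) (x : I.H) :
    I.proj n ((r : PowerSeries ℤ_[p]) • x) =
      aeval ((conjMap (tateRep W p).toTopRep (κ.layerSubgroup n) γ 1).hom.toLinearMap - 1) r
        (I.proj n x) := by
  induction r using Polynomial.induction_on generalizing x with
  | C c =>
    rw [Polynomial.coe_C, I.proj_C_smul, aeval_C, Module.algebraMap_end_apply]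
  | add f₁ f₂ h₁ h₂ =>
    rw [Polynomial.coe_add, add_smul, map_add, h₁, h₂, map_add, LinearMap.add_apply]
  | monomial k c hk =>
    rw [pow_succ, ← mul_assoc, Polynomial.coe_mul, Polynomial.coe_X, mul_smul, hk, I.proj_T_smul]
    conv_rhs => rw [map_mul, Module.End.mul_apply, aeval_X, LinearMap.sub_apply, Module.End.one_apply]
    rfl

/-- **`ω_n` kills the `n`-th layer**: `proj n (ω_n • x) = 0` for `ω_n = (X+1)^{p^n} − 1`, since
`conj_γ^{p^n} = conj_{γ^{p^n}} = 1` on `H¹(ℚ_n, T_pW)` (`γ^{p^n} ∈ Gal(ℚ̄/ℚ_n)`, inner automorphisms act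
trivially). [cite: Kato2004Asterisque, §12.2 (p. 220)] [cite: Lang1990, Ch. 5 §1 Thm. 1.1] -/
theorem proj_omega_smul (hγ : κ.IsTopGenerator γ) (n : ℕ) (x : I.H) :
    I.proj n ((((X + 1 : ℤ_[p][X]) ^ p ^ n - 1 : ℤ_[p][X]) : PowerSeries ℤ_[p]) • x) = 0 := by
  rw [proj_coe_smul]
  have hθ := conjMap_toLinearMap_pow_eq_one (tateRep W p).toTopRep (κ.layerSubgroup n)
    (pow_mem_layerSubgroup'' hγ n)
  simp [map_sub, map_pow, map_add, aeval_X, sub_add_cancel, hθ]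

/-- **The `Λ`-action of ANY datum is levelwise (the pin is rigid).**  For every power series `f` and
every polynomial `r ≡ f (mod ω_n)`: `proj n (f • x) = r(conj_γ − 1) (proj n x)`.  Proof: `f = r + ω_n q`
and `f • x = r • x + ω_n • (q • x)` by commutativity of `Λ`; the second term vanishes at level `n`
(`proj_omega_smul`) whatever `q • x` is — no topology on `I.H` is used.
[cite: Kato2004Asterisque, §12.2 (p. 220)] [cite: Lang1990, Ch. 5 §1 Thm. 1.1] -/
theorem proj_smul (hγ : κ.IsTopGenerator γ) (n : ℕ) {f : PowerSeries ℤ_[p]} {r : ℤ_[p][X]}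
    (hfr : f - (r : PowerSeries ℤ_[p]) ∈
      Ideal.span {(((X + 1 : ℤ_[p][X]) ^ p ^ n - 1 : ℤ_[p][X]) : PowerSeries ℤ_[p])})
    (x : I.H) :
    I.proj n (f • x) =
      aeval ((conjMap (tateRep W p).toTopRep (κ.layerSubgroup n) γ 1).hom.toLinearMap - 1) r
        (I.proj n x) := by
  obtain ⟨q, hq⟩ := Ideal.mem_span_singleton'.mp hfr
  have hf : f = (r : PowerSeries ℤ_[p]) +
      (((X + 1 : ℤ_[p][X]) ^ p ^ n - 1 : ℤ_[p][X]) : PowerSeries ℤ_[p]) * q := by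
    rw [mul_comm, hq, add_sub_cancel]
  rw [hf, add_smul, mul_smul, map_add, I.proj_omega_smul hγ, add_zero, proj_coe_smul]

variable (J : IwasawaH1Data W p κ γ)

/-- **Uniqueness of the pin `𝐇¹_Γ(T_pW)`**: any two data `I`, `J` are isomorphic as `Λ`-modules by an
isomorphism compatible with all the projections `proj n` (both project bijectively onto the
norm-compatible integral families, and the `Λ`-actions are levelwise, `proj_smul`).  In particular
every datum is isomorphic to the one of `nonempty_iwasawaH1Data_holds`.
[cite: Kato2004Asterisque, §12.2 (12.2.1) (p. 220) and §13.8 (p. 228)] [cite: Lang1990, Ch. 5 §1 Thm. 1.1] -/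
theorem exists_linearEquiv (hγ : κ.IsTopGenerator γ) :
    ∃ e : I.H ≃ₗ[IwasawaAlgebra p] J.H, ∀ (n : ℕ) (x : I.H), J.proj n (e x) = I.proj n x := by
  -- the set-map: lift the family of `x` to `J`
  have hex : ∀ x : I.H, ∃ y : J.H, ∀ n, J.proj n y = I.proj n x := fun x ↦
    J.proj_surjective _ (I.isNormCompatible_toFamily x)
  choose e he using hex
  have hadd : ∀ x x', e (x + x') = e x + e x' := fun x x' ↦
    J.ext_of_proj fun n ↦ by rw [he, map_add, map_add, he, he]
  have hsmul : ∀ (f : IwasawaAlgebra p) (x : I.H), e (f • x) = f • e x := fun f x ↦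
    J.ext_of_proj fun n ↦ by
      obtain ⟨r, hr⟩ := IwasawaH1Exists.exists_polynomial_sub_coe_mem_span p n f
      rw [he, I.proj_smul hγ n hr, J.proj_smul hγ n hr, he]
  let eₗ : I.H →ₗ[IwasawaAlgebra p] J.H :=
    { toFun := e, map_add' := hadd, map_smul' := hsmul }
  have hinj : Function.Injective eₗ := fun x x' h ↦
    I.ext_of_proj fun n ↦ by rw [← he x n, ← he x' n]; exact congrArg (J.proj n) h
  have hsurj : Function.Surjective eₗ := fun y ↦ by
    obtain ⟨x, hx⟩ := I.proj_surjective _ (J.isNormCompatible_toFamily y)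
    exact ⟨x, J.ext_of_proj fun n ↦ (he x n).trans (hx n)⟩
  exact ⟨LinearEquiv.ofBijective eₗ ⟨hinj, hsurj⟩, fun n x ↦ he x n⟩

/-- The isomorphism of `exists_linearEquiv` is unique: two maps `I.H → J.H` compatible with all
projections coincide (`proj_injective` of `J`). [cite: Kato2004Asterisque, §12.2 (p. 220)] -/
theorem eq_of_proj_comp_eq {e e' : I.H → J.H}
    (he : ∀ (n : ℕ) (x : I.H), J.proj n (e x) = I.proj n x)
    (he' : ∀ (n : ℕ) (x : I.H), J.proj n (e' x) = I.proj n x) : e = e' :=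
  funext fun x ↦ J.ext_of_proj fun n ↦ by rw [he, he']

end IwasawaH1Data

end Literature.NumberTheory.EllipticCurves.Kato2004

end
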